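import Mathlib
import HarnessLib
import Summits.Ventures.LatticeQCDFlow.StatementTwoDim
import Summits.Ventures.LatticeQCDFlow.Scaling.AutoregressiveContextLaw
import Summits.Ventures.LatticeQCDFlow.Scaling.EliminationFrontRaster

/-!
# Venture statement — LatticeQCDFlow — DRAFT, Part S21: THE AUTOREGRESSIVE-CONTEXT (ELIMINATION-
# FRONT) VOLUME LAW (lean-1 row 30, GEN-14; chain-completed and filed by lean-1 GEN-20 per LEAD LINE 411 —
# WAKE v75-thaw, theory2 v7.5)

HONEST FRAMING: exact (Metropolis-corrected) sampling algorithms for lattice gauge theory;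
figures of merit are autocorrelation/cost numbers at stated couplings and volumes; no
continuum-physics claim.

`Statement*.lean` is FROZEN through Mon 2026-08-25T09:00Z; this draft is STAGED in
`HOME/lean-1/thaw/` for the thaw-day lead and theory2 to word / number / file — it is NOT a
proposal.  It types THEORY-2.md §4 row T2-AF (b)/(d) (the triangular-footprint bracket of exact
AUTOREGRESSIVE samplers) as PROVED statements over the tree's substrate
(`Literature.Combinatorics.SimpleGraph.EliminationGraph`: `elimWidth`, `treewidth`;
`Literature.Probability.LatticeModels.LatticeGraph`: `torusGraph`; lean-1 GEN-14
`Scaling/EliminationFrontTorus.lean`, `Scaling/EliminationFrontRaster.lean`,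
`Scaling/AutoregressiveContextLaw.lean`):

* **S21 (a) THE ELIMINATION FRONT OF THE TORUS IS A CROSS-SECTION**: for `d ≥ 2`, `L ≥ 2`:
  for EVERY linear order of the sites of `(ℤ/L)^d` the elimination width is `≥ c_d·L^{d-1}`
  (`c_d = isoConst d (1/(8d))`: `1/32, 1/192, 1/1536` for `d = 2, 3, 4`), for the folded raster
  order it is `≤ 2·L^{d-1}`, and `c_d·L^{d-1} ≤ tw((ℤ/L)^d) ≤ 2·L^{d-1}`.
* **S21 (b) THE AUTOREGRESSIVE-CONTEXT LAW FOR THE FREE FIELD**: for `d ≥ 2`, `L ≥ 2`, `m ≠ 0` and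
  EVERY linear order of the sites, the Cholesky factorisation `-Δ + m² = L·diag(dv)·Lᵀ` (the exact
  autoregressive sampler `x_a | x_{≻a} ~ N(-Σ_{i≻a} L_{ia} x_i, 1/dv_a)`) has `L ≤ 0` off the
  diagonal, context of `a` = `{i ≻ a | L_{ia} ≠ 0}` = the higher fill-neighbourhood of `a`, SOME
  site with context `≥ c_d·L^{d-1}`, and `≥ c_d·L^{d-1}` sites pairwise dependent.
What is NOT claimed: interacting / gauge targets (THEORY-2 C5); the sharp constant; non-exact
(approximate) autoregressive models.  Nothing numerical is asserted; no `sorry`; the only new `def`s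
are the `Prop`s of record.
-/

noncomputable section

open Literature.Combinatorics.SimpleGraph Literature.LinearAlgebra.Matrix.ChordalSparsity
open Literature.Probability.LatticeModels (TorusSite torusGraph)
open Summit.Ventures.LatticeQCDFlow.Theory2.Autoregressive

namespace Summit.Ventures.LatticeQCDFlow

/-! ### Part S, appended — S21 (lean-1 GEN-14) -/

/-- **S21 (a) (THE ELIMINATION FRONT OF THE TORUS IS A CROSS-SECTION).**  For `d ≥ 2`, `L ≥ 2`:
every linear order `o` of the sites of `(ℤ/L)^d` has `c_d·L^{d-1} ≤ elimWidth`, the folded raster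
order has `elimWidth ≤ 2·L^{d-1}`, and `c_d·L^{d-1} ≤ tw((ℤ/L)^d) ≤ 2·L^{d-1}`
(`c_d = isoConst d (1/(8d))`).  PROVED: `Theory2.Autoregressive.torus_le_elimWidth`,
`torus_elimWidth_foldedRaster_le`, `torus_le_treewidth`, `torus_treewidth_le` (lean-1 GEN-14). -/
def S21a_EliminationFrontTorus : Prop :=
  ∀ (d L : ℕ) [NeZero L], 2 ≤ d → 2 ≤ L →
    (∀ o : LinearOrder (TorusSite d L),
      isoConst d (1 / (8 * d)) * (L : ℝ) ^ (d - 1) ≤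
        (@elimWidth (TorusSite d L) o _ (torusGraph d L) : ℝ)) ∧
    @elimWidth (TorusSite d L) (foldedRasterOrder d L) _ (torusGraph d L) ≤ 2 * L ^ (d - 1) ∧
    isoConst d (1 / (8 * d)) * (L : ℝ) ^ (d - 1) ≤ (treewidth (torusGraph d L) : ℝ) ∧
    treewidth (torusGraph d L) ≤ 2 * L ^ (d - 1)

/-- S21 (a) holds. -/
theorem S21a_EliminationFrontTorus_holds : S21a_EliminationFrontTorus :=
  fun _ _ _ hd hL => ⟨fun o => torus_le_elimWidth hd hL o, torus_elimWidth_foldedRaster_le hL,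
    torus_le_treewidth hd hL, torus_treewidth_le hL⟩

/-- S21 (b) at a FIXED linear order of the sites (a typeclass argument): the law for `-Δ + m²`.
PROVED: `Theory2.Autoregressive.freeField_context_law`. -/
def S21b_AutoregressiveContextLawAt (d L : ℕ) [NeZero L] [LinearOrder (TorusSite d L)] (m : ℝ) :
    Prop :=
  ∃ (Lc : Matrix (TorusSite d L) (TorusSite d L) ℝ) (dv : TorusSite d L → ℝ),
    IsUnitLowerTriangular Lc ∧ (∀ a, 0 < dv a) ∧
    freeFieldPrecision d L m = Lc * Matrix.diagonal dv * Lc.transpose ∧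
    (∀ i a, i ≠ a → Lc i a ≤ 0) ∧
    (∀ i a, a < i → (Lc i a ≠ 0 ↔ (elimGraph (torusGraph d L)).Adj a i)) ∧
    (∃ a, isoConst d (1 / (8 * d)) * (L : ℝ) ^ (d - 1) ≤
      ({i | a < i ∧ Lc i a ≠ 0} : Set (TorusSite d L)).ncard) ∧
    (∃ K : Finset (TorusSite d L), isoConst d (1 / (8 * d)) * (L : ℝ) ^ (d - 1) ≤ K.card ∧
      ∀ a ∈ K, ∀ i ∈ K, a < i → Lc i a < 0)

/-- **S21 (b) (THE AUTOREGRESSIVE-CONTEXT LAW FOR THE MASSIVE FREE FIELD).**  For `d ≥ 2`, `L ≥ 2`,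
`m ≠ 0` and EVERY linear order `o` of the sites of `(ℤ/L)^d`: `-Δ + m² = L·diag(dv)·Lᵀ` with `L`
unit lower triangular for `o`, `dv > 0`, `L i a ≤ 0` (`i ≠ a`), `L i a ≠ 0 ↔ {a,i}` a fill edge
(`a ≺ i`), some site `a` with `#{i ≻ a | L i a ≠ 0} ≥ c_d·L^{d-1}`, and a set `K` of
`≥ c_d·L^{d-1}` sites with `L i a < 0` for all `a ≺ i` in `K`.  PROVED:
`Theory2.Autoregressive.freeField_context_law` (lean-1 GEN-14). -/
def S21b_AutoregressiveContextLaw : Prop :=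
  ∀ (d L : ℕ) [NeZero L] (o : LinearOrder (TorusSite d L)) (m : ℝ), 2 ≤ d → 2 ≤ L → m ≠ 0 →
    @S21b_AutoregressiveContextLawAt d L _ o m

/-- S21 (b) holds. -/
theorem S21b_AutoregressiveContextLaw_holds : S21b_AutoregressiveContextLaw :=
  fun _ _ _ o _ hd hL hm => @freeField_context_law _ _ _ o hd hL _ hm

/-- **The venture's theory statement through Part S21** (LEAD LINE 411 CHAIN RULE): everything through
S20 (`StatementTwoDim`) and the autoregressive-context volume law S21 (a), (b). -/
def TheoryStatementS21 : Prop :=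
  TheoryStatementS20 ∧ S21a_EliminationFrontTorus ∧ S21b_AutoregressiveContextLaw

/-- The statement through S21 holds. -/
theorem TheoryStatementS21_holds : TheoryStatementS21 :=
  ⟨TheoryStatementS20_holds, S21a_EliminationFrontTorus_holds, S21b_AutoregressiveContextLaw_holds⟩

end Summit.Ventures.LatticeQCDFlow

end
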